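import Mathlib
import Summits.Ventures.HodgeRepro.Tier4.Line1.RTFSetting
import Summits.Ventures.HodgeRepro.Tier4.Line1.KernelUnfold
import Summits.Ventures.HodgeRepro.Tier4.Line1.RtfUnfold
import Summits.Ventures.HodgeRepro.Tier4.Line1.RtfSpectralStep
import Summits.Ventures.HodgeRepro.Tier4.Line1.InnerCalculus
import Summits.Ventures.HodgeRepro.Tier4.Common.L1Convolution

/-!
# Tier4/Line4/SpectralL1Unfold — the COUNTABLE unfolding of the kernel for an `L¹` first test function

Blind re-derivation cell `pub-hodge-repro`, Tier 4 «PROVE THE STEP» (README §9–§10), LINE L4, cut §15 (3′)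
`RtfSpectralL1` (lead (R-14) S14858; statement line S14886: (3) as displayed is FALSE, (3′) = (3) + the Poincaré
clause on the FIRST test is what is proved), seat t4-L2-p3 (gen 4); module 1 of 2 (the unfolding).

The tree's compactly supported chain (L1-p3's `KernelUnfold`/`KernelSpectral`, L1-p4's `RtfUnfold`/`RtfSpectralStep`)
unfolds `∫_G = ∫_{DG} ∑_{γ ∈ G(k)}` through the FINITELY many rational points meeting a compact window.  For a first
test `f₁ ∈ L¹ ∩ C` the window is all of `G`; with `G` second countable the discrete closed `G(k)` is COUNTABLE and
Mathlib's `IsFundamentalDomain.integral_eq_tsum''` + `integral_tsum` do the unfolding: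

* `integral_eq_setIntegral_tsum_of_integrable` (L1-p4's `countable_Gk`, InnerCalculus, by name): `∫_G H = ∫_{DG} ∑_γ H(γw)` for `H ∈ L¹`;
* `aestronglyMeasurable_tsum_Gk`: a pointwise a.e.-summable series of measurable functions over `G(k)` is measurable;
* `R_cj_eq_L1`: `(R(f̄)φ)(x) = ∫_{DG} conj K_f(x, w) φ(w) dw` for `f ∈ L¹ ∩ C` and a continuous invariant `φ`;
* `exists_bound_tsum_norm_kernel`: `∑_γ ‖f₂(w⁻¹ γ y)‖ ≤ C` for a.e. `w` (a test function `f₂`: finitely many terms on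
  `closure DG`, left `G(k)`-invariance, `ae_covers`); `kernel_conv_eq_L1`:
  `K_{f₁⋆f₂}(x, y) = ∫_{DG} K_{f₁}(x, w) K_{f₂}(w, y) dw` for `f₁ ∈ L¹ ∩ C`, `f₂` a test function;
* `kernel_left_memLp_of_bound`: `K_{f₁}(x, ·) ∈ L²(DG)` when `∑_γ ‖f₁(x⁻¹ γ w)‖ ≤ M` on `DG` — the POINCARÉ clause of
  the statement, the one hypothesis the compactly supported proof got for free; `exists_bound_sum_sq_norm_R_L1`:
  Bessel's bound `∑_{j ∈ s} ‖R(f̄₁)φ_j(x)‖² ≤ μ(DG) M²` uniformly on a compact `C₁` from the Poincaré clause on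
  `C₁ × closure DG`, with `summable_sq_norm_R_L1` / `exists_bound_tsum_sq_norm_R_L1`.

Mathlib + the landed L1 / Common modules only; no printed input; nothing here asserts anything about the truth of (P);
HC_CM is NOT proved by anyone in this repository.
-/

set_option autoImplicit false

noncomputable section

namespace Summit.Ventures.HodgeRepro.Tier4.Line1.RTF.Setting

open MeasureTheory Topology Filter Summit.Ventures.HodgeRepro.Tier4.Common
  Summit.Ventures.HodgeRepro.Tier4.Line1
open scoped Pointwise ENNReal

variable {G : Type} [Group G] [TopologicalSpace G] [IsTopologicalGroup G] [MeasurableSpace G] [BorelSpace G]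
  (S : Setting G)

/-! ## 1. The countable unfolding (`G(k)` countable: L1-p4's `countable_Gk`) -/

omit [IsTopologicalGroup G] [BorelSpace G] in
/-- the action of `G(k)` on `G` is left multiplication -/
theorem Gk_smul_eq (γ : S.Gk) (w : G) : γ • w = (γ : G) * w := rfl

/-- **the countable unfolding** `∫_G H = ∫_{DG} ∑_{γ ∈ G(k)} H(γ w)` for an integrable `H`
(`IsFundamentalDomain.integral_eq_tsum''` and `integral_tsum`, the `enorm` series of the translates summing to
`∫⁻_G ‖H‖ₑ < ∞` by `lintegral_eq_tsum''`). -/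
theorem integral_eq_setIntegral_tsum_of_integrable [SecondCountableTopology G] {H : G → ℂ}
    (hH : Integrable H S.μ) :
    ∫ w, H w ∂S.μ = ∫ w in S.DG, ∑' γ : S.Gk, H (γ * w) ∂S.μ := by
  haveI := S.haar
  haveI := S.countable_Gk
  rw [S.fdG.integral_eq_tsum'' H hH]
  simp only [S.Gk_smul_eq]
  symm
  refine integral_tsum (fun γ => (hH.comp_mul_left (γ : G)).aestronglyMeasurable.restrict) ?_
  have h := S.fdG.lintegral_eq_tsum'' (fun w => ‖H w‖ₑ)
  simp only [S.Gk_smul_eq] at h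
  rw [← h]
  exact ne_of_lt hH.hasFiniteIntegral

omit [IsTopologicalGroup G] [BorelSpace G] in
/-- a series over `G(k)` of a.e.-strongly measurable functions, summable a.e., is a.e.-strongly measurable (the
partial sums over `Finset G(k)` converge along a countably generated filter). -/
theorem aestronglyMeasurable_tsum_Gk [Countable S.Gk] {ν : Measure G} {F : S.Gk → G → ℂ}
    (hF : ∀ γ, AEStronglyMeasurable (F γ) ν) (hs : ∀ᵐ w ∂ν, Summable (fun γ => F γ w)) :
    AEStronglyMeasurable (fun w => ∑' γ, F γ w) ν := by
  refine aestronglyMeasurable_of_tendsto_ae (SummationFilter.unconditional S.Gk).filter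
    (f := fun s w => ∑ γ ∈ s, F γ w) (fun s => Finset.aestronglyMeasurable_fun_sum s fun γ _ => hF γ) ?_
  filter_upwards [hs] with w hw
  exact hw.hasSum

/-! ## 2. `R(f̄)φ` unfolded over `DG` for `f ∈ L¹` -/

/-- (T3a for `L¹`) `(R(f̄)φ)(x) = ∫_{DG} conj K_f(x, w) · φ(w) dw` for `f ∈ L¹ ∩ C` and a continuous invariant `φ`
(bounded on `G`): one left-invariant substitution, the countable unfolding, and the invariance of `φ`. -/
theorem R_cj_eq_L1 [SecondCountableTopology G] {f : G → ℂ} (hf : IsTestL1 S f) {φ : G → ℂ}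
    (hφc : Continuous φ) (hφ : S.Invariant φ) (x : G) :
    S.R (cj f) φ x = ∫ w in S.DG, starRingEnd ℂ (S.kernel f x w) * φ w ∂S.μ := by
  haveI := S.haar
  have h1 : S.R (cj f) φ x = ∫ w, starRingEnd ℂ (f (x⁻¹ * w)) * φ w ∂S.μ := by
    unfold Setting.R cj
    have := integral_mul_left_eq_self (μ := S.μ) (fun g => starRingEnd ℂ (f g) * φ (x * g)) x⁻¹
    simp only [mul_inv_cancel_left] at this
    exact this.symm
  obtain ⟨B, -, hB⟩ := S.exists_bound_of_invariant hφ hφc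
  have h2 : Integrable (fun w => starRingEnd ℂ (f (x⁻¹ * w))) S.μ := by
    have := (IsTestL1.cj S hf).2.comp_mul_left x⁻¹
    exact this
  have hint : Integrable (fun w => starRingEnd ℂ (f (x⁻¹ * w)) * φ w) S.μ :=
    h2.mul_bdd (c := B) hφc.aestronglyMeasurable (Eventually.of_forall hB)
  rw [h1, S.integral_eq_setIntegral_tsum_of_integrable hint]
  apply setIntegral_congr_fun₀ S.fdG.nullMeasurableSet
  intro w _
  simp only
  unfold Setting.kernel
  rw [Complex.conj_tsum, ← tsum_mul_right]
  apply tsum_congr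
  intro γ
  rw [hφ γ w, mul_assoc]

/-! ## 3. The kernel of a test function is bounded along `G(k)`-orbits; the composition formula -/

omit [BorelSpace G] in
/-- for a test function `f` and `w ∈ closure DG`, the terms `f(w⁻¹ γ y)` vanish outside the finite set `Γ_y` of rational
points of `closure DG · tsupport f · y⁻¹`. -/
theorem finite_support_kernel_term {f : G → ℂ} (hf : IsTest f) (y : G) :
    ∃ Γ : Finset S.Gk, ∀ γ : S.Gk, ∀ w ∈ closure S.DG, f (w⁻¹ * γ * y) ≠ 0 → γ ∈ Γ := by
  have hM : IsCompact ((fun p : G × G => p.1 * p.2 * y⁻¹) '' (closure S.DG ×ˢ tsupport f)) :=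
    (S.compG.prod hf.compact).image (by fun_prop)
  obtain hfin := S.finite_rational_of_isCompact hM
  refine ⟨hfin.toFinset, fun γ w hw hne => ?_⟩
  rw [Set.Finite.mem_toFinset]
  refine ⟨(w, w⁻¹ * γ * y), ⟨hw, subset_tsupport _ hne⟩, ?_⟩
  simp only
  group

omit [BorelSpace G] in
/-- for a test function `f` and ANY `w`, the family `γ ↦ f(w⁻¹ γ y)` has finite support (the rational points of the
compact `w · tsupport f · y⁻¹`). -/
theorem summable_kernel_term {f : G → ℂ} (hf : IsTest f) (w y : G) :
    Summable (fun γ : S.Gk => f (w⁻¹ * γ * y)) ∧ Summable (fun γ : S.Gk => ‖f (w⁻¹ * γ * y)‖) := by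
  have hM : IsCompact ((fun p : G => w * p * y⁻¹) '' tsupport f) := hf.compact.image (by fun_prop)
  obtain hfin := S.finite_rational_of_isCompact hM
  have hΓ : ∀ γ : S.Gk, f (w⁻¹ * γ * y) ≠ 0 → γ ∈ hfin.toFinset := by
    intro γ hne
    rw [Set.Finite.mem_toFinset]
    refine ⟨w⁻¹ * γ * y, subset_tsupport _ hne, ?_⟩
    simp only
    group
  constructor
  · refine summable_of_ne_finset_zero (s := hfin.toFinset) fun γ hγ => ?_
    by_contra hne
    exact hγ (hΓ γ hne)
  · refine summable_of_ne_finset_zero (s := hfin.toFinset) fun γ hγ => ?_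
    by_contra hne
    exact hγ (hΓ γ (fun h0 => hne (by rw [h0, norm_zero])))

omit [IsTopologicalGroup G] [BorelSpace G] in
/-- left `G(k)`-invariance of the absolute kernel `∑_γ ‖f(w⁻¹ γ y)‖` in `w`. -/
theorem tsum_norm_kernel_term_mul_left (f : G → ℂ) (δ : S.Gk) (w y : G) :
    ∑' γ : S.Gk, ‖f (((δ : G) * w)⁻¹ * γ * y)‖ = ∑' γ : S.Gk, ‖f (w⁻¹ * γ * y)‖ := by
  rw [← (Equiv.mulLeft δ).tsum_eq]
  apply tsum_congr
  intro γ
  simp only [Equiv.coe_mulLeft, Subgroup.coe_mul]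
  congr 2
  group

omit [BorelSpace G] in
/-- the absolute kernel of a test function is bounded on `closure DG` by `|Γ_y| · sup ‖f‖`. -/
theorem tsum_norm_kernel_term_le_of_mem_closure {f : G → ℂ} (hf : IsTest f) (y : G) :
    ∃ C : ℝ, 0 ≤ C ∧ ∀ w ∈ closure S.DG, ∑' γ : S.Gk, ‖f (w⁻¹ * γ * y)‖ ≤ C := by
  obtain ⟨Γ, hΓ⟩ := S.finite_support_kernel_term hf y
  obtain ⟨Mf, hMf⟩ := hf.cont.bounded_above_of_compact_support hf.compact
  have hMf0 : 0 ≤ Mf := (norm_nonneg _).trans (hMf 1)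
  refine ⟨(Γ.card : ℝ) * Mf, by positivity, fun w hw => ?_⟩
  rw [tsum_eq_sum (s := Γ) (fun γ hγ => ?_)]
  · calc ∑ γ ∈ Γ, ‖f (w⁻¹ * γ * y)‖ ≤ ∑ _γ ∈ Γ, Mf := Finset.sum_le_sum fun γ _ => hMf _
      _ = (Γ.card : ℝ) * Mf := by rw [Finset.sum_const, nsmul_eq_mul]
  · by_contra hne
    exact hγ (hΓ γ w hw (fun h0 => hne (by rw [h0, norm_zero])))

omit [BorelSpace G] in
/-- **the absolute kernel of a test function is bounded a.e. on `G`**: a.e. `w` lies in a translate `γ • DG`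
(`ae_covers`), where the bound of `closure DG` holds by left invariance. -/
theorem exists_bound_tsum_norm_kernel {f : G → ℂ} (hf : IsTest f) (y : G) :
    ∃ C : ℝ, 0 ≤ C ∧ ∀ᵐ w ∂S.μ, ∑' γ : S.Gk, ‖f (w⁻¹ * γ * y)‖ ≤ C := by
  haveI := S.haar
  obtain ⟨C, hC0, hC⟩ := S.tsum_norm_kernel_term_le_of_mem_closure hf y
  refine ⟨C, hC0, ?_⟩
  filter_upwards [S.fdG.ae_covers] with w hw
  obtain ⟨g, hg⟩ := hw
  have h1 := hC (g • w) (subset_closure hg)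
  rw [S.Gk_smul_eq, S.tsum_norm_kernel_term_mul_left f g w y] at h1
  exact h1

omit [BorelSpace G] in
/-- `K_f(·, y)` is bounded a.e. on `G` for a test function `f`. -/
theorem exists_bound_kernel_right {f : G → ℂ} (hf : IsTest f) (y : G) :
    ∃ C : ℝ, 0 ≤ C ∧ ∀ᵐ w ∂S.μ, ‖S.kernel f w y‖ ≤ C := by
  obtain ⟨C, hC0, hC⟩ := S.exists_bound_tsum_norm_kernel hf y
  refine ⟨C, hC0, ?_⟩
  filter_upwards [hC] with w hw
  exact (norm_tsum_le_tsum_norm (S.summable_kernel_term hf w y).2).trans hw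

/-- `K_f(·, y)` is a.e.-strongly measurable for a test function `f` (a pointwise summable series of continuous
functions over the countable `G(k)`). -/
theorem aestronglyMeasurable_kernel_right [Countable S.Gk] {f : G → ℂ} (hf : IsTest f) (y : G) :
    AEStronglyMeasurable (fun w => S.kernel f w y) S.μ :=
  S.aestronglyMeasurable_tsum_Gk (fun γ => (hf.cont.comp (by fun_prop)).aestronglyMeasurable)
    (Eventually.of_forall fun w => (S.summable_kernel_term hf w y).1)

/-- **(T3c for `L¹`) the kernel of a convolution is the composition of the kernels over `DG`**:
`K_{f₁⋆f₂}(x, y) = ∫_{DG} K_{f₁}(x, w) K_{f₂}(w, y) dw` for `f₁ ∈ L¹ ∩ C` and a test function `f₂` — the substitution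
`h = x⁻¹ w` inside the convolution, the sum over `G(k)` through the integral over `G` (`integral_tsum`, dominated by
`‖f₁(x⁻¹ w)‖ · ∑_γ ‖f₂(w⁻¹ γ y)‖ ≤ C ‖f₁(x⁻¹ w)‖`), then the countable unfolding and `kernel_mul_left`. -/
theorem kernel_conv_eq_L1 [SecondCountableTopology G] {f₁ f₂ : G → ℂ} (h₁ : IsTestL1 S f₁) (h₂ : IsTest f₂)
    (x y : G) :
    S.kernel (S.conv f₁ f₂) x y = ∫ w in S.DG, S.kernel f₁ x w * S.kernel f₂ w y ∂S.μ := by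
  haveI := S.haar
  haveI := S.countable_Gk
  -- the substitution `h = x⁻¹ w` inside the convolution
  have h1 : ∀ γ : S.Gk, S.conv f₁ f₂ (x⁻¹ * γ * y) = ∫ w, f₁ (x⁻¹ * w) * f₂ (w⁻¹ * γ * y) ∂S.μ := by
    intro γ
    unfold Setting.conv
    have := integral_mul_left_eq_self (μ := S.μ) (fun h => f₁ h * f₂ (h⁻¹ * (x⁻¹ * γ * y))) x⁻¹
    rw [← this]
    congr 1
    funext w
    congr 2
    group
  -- the integrands
  obtain ⟨Mf, hMf⟩ := h₂.cont.bounded_above_of_compact_support h₂.compact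
  have hf₁x : Integrable (fun w => f₁ (x⁻¹ * w)) S.μ := h₁.2.comp_mul_left x⁻¹
  have hFint : ∀ γ : S.Gk, Integrable (fun w => f₁ (x⁻¹ * w) * f₂ (w⁻¹ * γ * y)) S.μ := fun γ =>
    hf₁x.mul_bdd (c := Mf) (h₂.cont.comp (by fun_prop)).aestronglyMeasurable (Eventually.of_forall fun w => hMf _)
  obtain ⟨C, hC0, hC⟩ := S.exists_bound_tsum_norm_kernel h₂ y
  -- the sum over `G(k)` passes through the integral over `G`
  have h2 : S.kernel (S.conv f₁ f₂) x y = ∫ w, f₁ (x⁻¹ * w) * S.kernel f₂ w y ∂S.μ := by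
    show ∑' γ : S.Gk, S.conv f₁ f₂ (x⁻¹ * γ * y) = _
    simp_rw [h1]
    rw [← integral_tsum (fun γ => (hFint γ).aestronglyMeasurable) ?_]
    · congr 1
      funext w
      unfold Setting.kernel
      rw [tsum_mul_left]
    · rw [← lintegral_tsum (fun γ => (hFint γ).aestronglyMeasurable.enorm)]
      have hle : ∀ᵐ w ∂S.μ, ∑' γ : S.Gk, ‖f₁ (x⁻¹ * w) * f₂ (w⁻¹ * γ * y)‖ₑ ≤
          ‖f₁ (x⁻¹ * w)‖ₑ * ENNReal.ofReal C := by
        filter_upwards [hC] with w hw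
        simp_rw [enorm_mul]
        rw [ENNReal.tsum_mul_left]
        refine mul_le_mul' le_rfl ?_
        have hs := (S.summable_kernel_term h₂ w y).2
        calc ∑' γ : S.Gk, ‖f₂ (w⁻¹ * γ * y)‖ₑ = ∑' γ : S.Gk, ENNReal.ofReal ‖f₂ (w⁻¹ * γ * y)‖ := by
              simp only [ofReal_norm]
          _ = ENNReal.ofReal (∑' γ : S.Gk, ‖f₂ (w⁻¹ * γ * y)‖) :=
              (ENNReal.ofReal_tsum_of_nonneg (fun γ => norm_nonneg _) hs).symm
          _ ≤ ENNReal.ofReal C := ENNReal.ofReal_le_ofReal hw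
      refine ne_of_lt ((lintegral_mono_ae hle).trans_lt ?_)
      rw [lintegral_mul_const' _ _ ENNReal.ofReal_ne_top]
      exact ENNReal.mul_lt_top hf₁x.hasFiniteIntegral ENNReal.ofReal_lt_top
  -- the integrand `f₁(x⁻¹ w) K_{f₂}(w, y)` is integrable: the countable unfolding applies
  obtain ⟨C', -, hC'⟩ := S.exists_bound_kernel_right h₂ y
  have hint : Integrable (fun w => f₁ (x⁻¹ * w) * S.kernel f₂ w y) S.μ :=
    hf₁x.mul_bdd (c := C') (S.aestronglyMeasurable_kernel_right h₂ y) hC'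
  rw [h2, S.integral_eq_setIntegral_tsum_of_integrable hint]
  apply setIntegral_congr_fun₀ S.fdG.nullMeasurableSet
  intro w _
  simp only [S.kernel_mul_left f₂]
  rw [tsum_mul_right]
  congr 1
  unfold Setting.kernel
  apply tsum_congr
  intro δ
  rw [mul_assoc]

/-! ## 4. The Poincaré clause: `K_{f₁}(x, ·) ∈ L²(DG)` and Bessel's bound -/

/-- `K_f(x, ·)` is a.e.-strongly measurable on `DG` when the series is summable on `DG`. -/
theorem aestronglyMeasurable_kernel_left_restrict [Countable S.Gk] {f : G → ℂ} (hf : Continuous f) (x : G)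
    (hs : ∀ w ∈ S.DG, Summable (fun γ : S.Gk => f (x⁻¹ * γ * w))) :
    AEStronglyMeasurable (fun w => S.kernel f x w) (S.μ.restrict S.DG) := by
  refine S.aestronglyMeasurable_tsum_Gk (fun γ => (hf.comp (by fun_prop)).aestronglyMeasurable) ?_
  filter_upwards [ae_restrict_mem₀ S.fdG.nullMeasurableSet] with w hw
  exact hs w hw

/-- **`K_f(x, ·) ∈ L²(DG, μ)` from the Poincaré clause at `x`**: the series `∑_γ ‖f(x⁻¹ γ w)‖` is summable and
bounded by `M` on `DG`, so `K_f(x, ·)` is bounded by `M` there (finite measure). -/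
theorem kernel_left_memLp_of_bound [Countable S.Gk] {f : G → ℂ} (hf : Continuous f) (x : G) {M : ℝ}
    (hP : ∀ w ∈ S.DG, Summable (fun γ : S.Gk => ‖f (x⁻¹ * γ * w)‖) ∧
      ∑' γ : S.Gk, ‖f (x⁻¹ * γ * w)‖ ≤ M) :
    MemLp (fun w => S.kernel f x w) 2 (S.μ.restrict S.DG) := by
  haveI := S.isFiniteMeasure_restrict_DG
  refine MemLp.of_bound (S.aestronglyMeasurable_kernel_left_restrict hf x fun w hw => (hP w hw).1.of_norm) M ?_
  filter_upwards [ae_restrict_mem₀ S.fdG.nullMeasurableSet] with w hw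
  exact (norm_tsum_le_tsum_norm (hP w hw).1).trans (hP w hw).2

/-- the `L²(DG)` inner product of the kernel section with `φ` is `conj (R(f̄)φ(x))` (`R_cj_eq_L1`). -/
theorem inner_kernel_left_eq [SecondCountableTopology G] {f : G → ℂ} (hf : IsTestL1 S f) {φ : G → ℂ}
    (hφc : Continuous φ) (hφ : S.Invariant φ) (x : G) :
    S.inner (fun w => S.kernel f x w) φ = starRingEnd ℂ (S.R (cj f) φ x) := by
  rw [S.R_cj_eq_L1 hf hφc hφ x]
  unfold Setting.inner
  rw [← integral_conj]
  congr 1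
  funext w
  simp only [map_mul, Complex.conj_conj]

/-- **THE UNIFORM COEFFICIENT BOUND FOR AN `L¹` FIRST TEST** (the twin of L1-p4's `exists_bound_sum_sq_norm_R`):
under the Poincaré clause on `C₁ × closure DG` — `∑_γ ‖f(x⁻¹ γ w)‖ ≤ M` for `x ∈ C₁`, `w ∈ closure DG` — Bessel's
inequality for the orthonormal `φ_j` gives `∑_{j ∈ s} ‖R(f̄)φ_j(x)‖² ≤ μ(DG) M²` for every finite `s` and `x ∈ C₁`. -/
theorem exists_bound_sum_sq_norm_R_L1 [SecondCountableTopology G] {f : G → ℂ} (hf : IsTestL1 S f)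
    {τ : ℕ → Set (G → ℂ)} {φ : ℕ → G → ℂ} {n : ℕ → ℕ} (hB : S.IsAdaptedONB τ φ n) {C₁ : Set G} {M : ℝ}
    (hP : ∀ x ∈ C₁, ∀ w ∈ closure S.DG, Summable (fun γ : S.Gk => ‖f (x⁻¹ * γ * w)‖) ∧
      ∑' γ : S.Gk, ‖f (x⁻¹ * γ * w)‖ ≤ M) :
    ∃ M' : ℝ, 0 ≤ M' ∧ ∀ x ∈ C₁, ∀ s : Finset ℕ, ∑ j ∈ s, ‖S.R (cj f) (φ j) x‖ ^ 2 ≤ M' := by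
  haveI := S.haar
  haveI := S.countable_Gk
  haveI := S.isFiniteMeasure_DG
  refine ⟨S.μ.real S.DG * M ^ 2, by positivity, ?_⟩
  intro x hx s
  have hφc : ∀ j, Continuous (φ j) := fun j => (hB.inv (n j)).cont _ (hB.mem j)
  have hφinv : ∀ j, S.Invariant (φ j) := fun j => (hB.inv (n j)).inv _ (hB.mem j)
  have hPx : ∀ w ∈ S.DG, Summable (fun γ : S.Gk => ‖f (x⁻¹ * γ * w)‖) ∧
      ∑' γ : S.Gk, ‖f (x⁻¹ * γ * w)‖ ≤ M := fun w hw => hP x hx w (subset_closure hw)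
  have hwL : MemLp (fun w => S.kernel f x w) 2 (S.μ.restrict S.DG) := S.kernel_left_memLp_of_bound hf.1 x hPx
  have hcoef : ∀ j, S.inner (fun w => S.kernel f x w) (φ j) = starRingEnd ℂ (S.R (cj f) (φ j) x) :=
    fun j => S.inner_kernel_left_eq hf (hφc j) (hφinv j) x
  have hbes := S.bessel_finset hφc hB.orth hwL s
  calc ∑ j ∈ s, ‖S.R (cj f) (φ j) x‖ ^ 2 = ∑ j ∈ s, ‖S.inner (fun w => S.kernel f x w) (φ j)‖ ^ 2 := by
        simp_rw [hcoef, RCLike.norm_conj]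
    _ ≤ ∫ w in S.DG, ‖S.kernel f x w‖ ^ 2 ∂S.μ := hbes
    _ ≤ ∫ _w in S.DG, M ^ 2 ∂S.μ := by
        apply integral_mono_of_nonneg (Eventually.of_forall fun w => by positivity) (integrable_const _)
        filter_upwards [ae_restrict_mem₀ S.fdG.nullMeasurableSet] with w hw
        show ‖S.kernel f x w‖ ^ 2 ≤ M ^ 2
        exact pow_le_pow_left₀ (norm_nonneg _)
          ((norm_tsum_le_tsum_norm (hPx w hw).1).trans (hPx w hw).2) 2
    _ = S.μ.real S.DG * M ^ 2 := by rw [setIntegral_const, smul_eq_mul]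

/-- pointwise: the coefficient series `∑_j ‖R(f̄)φ_j(x)‖²` is summable under the Poincaré clause at `x`. -/
theorem summable_sq_norm_R_L1 [SecondCountableTopology G] {f : G → ℂ} (hf : IsTestL1 S f)
    {τ : ℕ → Set (G → ℂ)} {φ : ℕ → G → ℂ} {n : ℕ → ℕ} (hB : S.IsAdaptedONB τ φ n) (x : G) {M : ℝ}
    (hP : ∀ w ∈ closure S.DG, Summable (fun γ : S.Gk => ‖f (x⁻¹ * γ * w)‖) ∧
      ∑' γ : S.Gk, ‖f (x⁻¹ * γ * w)‖ ≤ M) :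
    Summable fun j => ‖S.R (cj f) (φ j) x‖ ^ 2 := by
  obtain ⟨M', -, hM'⟩ := S.exists_bound_sum_sq_norm_R_L1 hf hB (C₁ := {x}) (M := M)
    (fun x' hx' w hw => by rw [Set.mem_singleton_iff.1 hx']; exact hP w hw)
  exact summable_of_sum_le (fun j => by positivity) (hM' x (Set.mem_singleton x))

/-- uniform: `∑' j, ‖R(f̄)φ_j(x)‖² ≤ M'` for all `x ∈ C₁` under the Poincaré clause on `C₁ × closure DG`. -/
theorem exists_bound_tsum_sq_norm_R_L1 [SecondCountableTopology G] {f : G → ℂ} (hf : IsTestL1 S f)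
    {τ : ℕ → Set (G → ℂ)} {φ : ℕ → G → ℂ} {n : ℕ → ℕ} (hB : S.IsAdaptedONB τ φ n) {C₁ : Set G} {M : ℝ}
    (hP : ∀ x ∈ C₁, ∀ w ∈ closure S.DG, Summable (fun γ : S.Gk => ‖f (x⁻¹ * γ * w)‖) ∧
      ∑' γ : S.Gk, ‖f (x⁻¹ * γ * w)‖ ≤ M) :
    ∃ M' : ℝ, 0 ≤ M' ∧ ∀ x ∈ C₁, ∑' j, ‖S.R (cj f) (φ j) x‖ ^ 2 ≤ M' := by
  obtain ⟨M', hM'0, hM'⟩ := S.exists_bound_sum_sq_norm_R_L1 hf hB hP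
  exact ⟨M', hM'0, fun x hx => Real.tsum_le_of_sum_le (fun j => by positivity) (hM' x hx)⟩

end Summit.Ventures.HodgeRepro.Tier4.Line1.RTF.Setting

end
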